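import Summits.BirchSwinnertonDyer.BirchSwinnertonDyer.Theorems.SmallImageMuTransferMuTransferX9ModPTwistSubmodules
import Summits.BirchSwinnertonDyer.Rank1Residual.GaloisImage.SmallImageInertiaOrder
import HarnessLib

/-!
# K6 crux `MuTransferX9` (stmt-BirchSwinnertonDyer-19276), stub `stub_coreX9`: MU-TRANSFER-PROOF (F2)/(F8)
# "`G ↠ Ḡ × Γ_e`" for a SMALL image — an element fixing `E[p]` with unit cyclotomic exponent, and
# Lemma 3 (i) on `𝒯_J(E)` under `Irr ∧ ¬Surj` alone

Cell `bsd-smallim`, seat `bsd-smallim-k6-c2` (gen 2). HONEST FRAMING: theorems only; nothing asserted about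
any curve; BSD is not advanced. For `W/ℚ` with `E[p]` irreducible and `ρ̄_{E,p}` NOT surjective (the X9
images 5Ns/5S4/7Ns and every other small irreducible image), `p ∤ #ρ̄(Γ_ℚ)` (tree
`GaloisImage.not_dvd_card_map_galoisRepTorsion_of_irr_of_not_surj`, Serre 1972 Prop. 15), so for a
topological generator `γ` of `κ` the element `γ^m`, `m = #ρ̄(Γ_ℚ)`, fixes `E[p]` and has `κ(γ^m) = m`, a
unit: `exists_fixing_twistExponent_not_dvd_of_irr_of_not_surj`. Consequently the `Γ_ℚ`-stable subgroups of
`𝒯_J(E) = E[p] ⊗ 𝔽_p[T]/(T^J)(χ_κ)` are the `T^j 𝒯_J(E)` (`modPTwist_stable_addSubgroup_eq_tPow_of_irr_of_not_surj`,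
from `LevelE.modPTwist_stable_addSubgroup_eq_tPow_of_unit`) — MU-TRANSFER-PROOF §4 Lemma 3 (i) with
exactly the image hypotheses of class X9.

References: HOME/koly/MU-TRANSFER-PROOF.md (F2), (F8), §4 Lemma 3 (i); J.-P. Serre, Invent. Math. 15 (1972)
§2.4 Prop. 15 [Serre1972]; L. Washington, *Introduction to Cyclotomic Fields* §13.2 [Washington1997].
-/

-- the summit and its single problem are both named `BirchSwinnertonDyer` (registry layout D-0017)
set_option linter.dupNamespace false

set_option autoImplicit false

noncomputable section

open Literature.NumberTheory.EllipticCurves Literature.NumberTheory.GaloisRepresentations Field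
open WeierstrassCurve

namespace Summit.BirchSwinnertonDyer.BirchSwinnertonDyer.Rank1Residual.LevelE

variable (W : WeierstrassCurve ℚ) [W.IsElliptic] (p : ℕ) [Fact p.Prime] (κ : ZpExtension ℚ p) (J : ℕ)

/-- **Small image ⟹ a generator of `Γ` fixing `E[p]` up to a unit** (MU-TRANSFER-PROOF (F2)/(F8)): if
`E[p]` is irreducible and `ρ̄_{E,p}` is not surjective, then for `J ≥ 1` and any topological generator
`γ` of `κ` there is `σ₀ ∈ Γ_ℚ` fixing `E[p]` pointwise with `κ(σ₀) mod p^J` prime to `p` — namely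
`σ₀ = γ^m`, `m = #ρ̄_{E,p}(Γ_ℚ)`, `p ∤ m` by Serre's Prop. 15
(`GaloisImage.not_dvd_card_map_galoisRepTorsion_of_irr_of_not_surj`). [cite: Serre1972, §2.4 Prop. 15] -/
theorem exists_fixing_twistExponent_not_dvd_of_irr_of_not_surj (hirr : W.HasIrreducibleModPGaloisRep p)
    (hns : ¬ W.HasSurjectiveModNGaloisRep p) (hJ : 1 ≤ J) {γ : absoluteGaloisGroup ℚ}
    (hγ : κ.IsTopGenerator γ) :
    ∃ σ₀ : absoluteGaloisGroup ℚ,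
      (∀ P : WeierstrassCurve.geomTorsion W (p : ℤ), σ₀ • P = P) ∧ ¬ p ∣ κ.twistExponent J σ₀ := by
  let G' : Subgroup (Multiplicative (AddAut (WeierstrassCurve.geomTorsion W (p : ℤ)))) :=
    (⊤ : Subgroup (absoluteGaloisGroup ℚ)).map (galoisRepTorsion W (p : ℤ))
  have hm : ¬ p ∣ Nat.card G' :=
    Summit.BirchSwinnertonDyer.Rank1Residual.GaloisImage.not_dvd_card_map_galoisRepTorsion_of_irr_of_not_surj
      W p hirr hns ⊤
  refine exists_fixing_twistExponent_not_dvd W p κ J hJ hm (fun σ P => ?_) hγ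
  -- `ρ̄(σ) ∈ G'`, so `ρ̄(σ)^{#G'} = 1`
  have hmem : galoisRepTorsion W (p : ℤ) σ ∈ G' := Subgroup.mem_map_of_mem _ (Subgroup.mem_top σ)
  have hpow : (galoisRepTorsion W (p : ℤ) σ) ^ Nat.card G' = 1 := by
    have h := pow_card_eq_one' (G := G') (x := ⟨galoisRepTorsion W (p : ℤ) σ, hmem⟩)
    exact congrArg Subtype.val h
  have := galoisRepTorsion_apply W (p : ℤ) (σ ^ Nat.card G') P
  rw [map_pow, hpow] at this
  exact this.symm

/-- **MU-TRANSFER-PROOF §4 Lemma 3 (i) for a small irreducible image**: if `E[p]` is irreducible and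
`ρ̄_{E,p}` is not surjective, then for `J ≥ 1` and the twist along any `ℤ_p`-extension `κ` with a
topological generator, every `Γ_ℚ`-stable subgroup of `𝒯_J(E)` is `T^j 𝒯_J(E)` for some `j ≤ J`
(`LevelE.modPTwist_stable_addSubgroup_eq_tPow_of_unit` + the previous theorem). The hypotheses are exactly
those of class X9 (`ClassX9 W p` gives `Irr` and `¬Surj`). [cite: Serre1972, §2.4 Prop. 15] -/
theorem modPTwist_stable_addSubgroup_eq_tPow_of_irr_of_not_surj (hirr : W.HasIrreducibleModPGaloisRep p)
    (hns : ¬ W.HasSurjectiveModNGaloisRep p) (hJ : 1 ≤ J) {γ : absoluteGaloisGroup ℚ}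
    (hγ : κ.IsTopGenerator γ)
    (N : AddSubgroup (Fin J → WeierstrassCurve.geomTorsion W (p : ℤ)))
    (hN : ∀ (σ : absoluteGaloisGroup ℚ) (x : Fin J → WeierstrassCurve.geomTorsion W (p : ℤ)),
      x ∈ N → W.modPTwist p κ J σ x ∈ N) :
    ∃ j : ℕ, j ≤ J ∧ ∀ x : Fin J → WeierstrassCurve.geomTorsion W (p : ℤ),
      x ∈ N ↔ ∀ i : Fin J, i.val < j → x i = 0 := by
  obtain ⟨σ₀, hσ₀E, hu⟩ := exists_fixing_twistExponent_not_dvd_of_irr_of_not_surj W p κ J hirr hns hJ hγ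
  exact modPTwist_stable_addSubgroup_eq_tPow_of_unit W p κ J hirr hσ₀E hu N hN

end Summit.BirchSwinnertonDyer.BirchSwinnertonDyer.Rank1Residual.LevelE

end
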